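import Literature.AlgebraicGeometry.Frobenioids.PrimaryStepsTransport
import Literature.AlgebraicGeometry.Frobenioids.FrobeniusConjugates
import Literature.AlgebraicGeometry.Frobenioids.PreFrobenioidPullbacks
import Literature.AlgebraicGeometry.Frobenioids.MonoidTransport
import HarnessLib

/-!
# Frobenioids I, Theorem 4.2 (ii): functoriality of `Ψ^Prime` with respect to morphisms of
# Frobenius type

Mochizuki, *The geometry of Frobenioids I: the general theory*, Kyushu J. Math. **62** (2008)
293–400, §4, Theorem 4.2 (ii), kurims text p. 77 (statement), p. 80 ll. 34–43 (proof)
[cite: MochizukiFrdI2008, Thm. 4.2 (ii) p.80]: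

  "To check the functoriality of `Ψ^Prime(−)` with respect to arbitrary base-isomorphisms, it
  suffices to check it with respect to morphisms of Frobenius type and pre-steps [cf. Proposition
  1.7, (ii)]. In the case of a morphism of Frobenius type `B_i → A_i` [where `i = 1, 2`], the desired
  functoriality follows by considering commutative diagrams `B'_i → B_i`, `A'_i → A_i`
  [cf. Proposition 1.10, (i)] — where the vertical morphisms are morphisms of Frobenius type, and
  the horizontal morphisms are primary steps."

PROVED here (sub-node `FrdI:Thm4.2(ii)/T42-L09` of `plan/L1/SUBDAG-FrdI-Thm42-Thm49.md`, holder
abc-iut-L1-t14; this piece abc-iut-L1-t2).  The functor `A ↦ Prime(Φ(A))` on `C^bs-iso` sends a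
base-isomorphism `γ : B → A` to the bijection `Prime(Φ(γ)) : Prime(Φ(A)) ⥲ Prime(Φ(B))` induced by
the monoid isomorphism `γ^* = Φ(Base γ) : Φ(A) ⥲ Φ(B)` (`Primes.congr (ElemFrobenioid.pullEquiv Φ (Base γ))`).
For bijections `e_A : Prime(Φ₁(A)) ≃ Prime(Φ₂(Ψ A))`, `e_B : Prime(Φ₁(B)) ≃ Prime(Φ₂(Ψ B))` with the
characteristic property of seat abc-iut-L1-t14's `existsUnique_primesEquiv` (the prime of `x_ε` goes
to the prime of `x_{Ψ(ε)}` for every primary pre-step `ε` into the object), a functor `Ψ` preserving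
morphisms of Frobenius type (Thm. 3.4 (iii), hypothesis `hfrob`) and primary pre-steps into `A`, `B`
(Thm. 4.2 (i), hypotheses `hprimA`, `hprimB`), and a morphism of Frobenius type `γ : B → A`, the square

  `Prime(Φ₁(A)) —e_A→ Prime(Φ₂(Ψ A))`
  `   | Prime(Φ₁(γ))        | Prime(Φ₂(Ψ γ))`
  `Prime(Φ₁(B)) —e_B→ Prime(Φ₂(Ψ B))`

commutes (`primesEquiv_naturality_frobeniusType`; carrier form `…_mem`).  The single-Frobenioid
input is the square of Prop. 1.10 (i) with a primary pre-step `ε' : B' → B` as top row, Frobenius-type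
columns `γ' : B' → A'` (Def. 1.3 (ii)) and `γ`, and the Frobenius conjugate `ε : A' → A` as bottom row
(seat abc-iut-L1-t1's `FrobeniusConjugates.lean`): then `γ^*(x_ε) = x_{ε'}^{deg γ}`
(`pull_base_invDiv_of_frobenius_sq`), so `ε` is again a primary pre-step and `Prime(Φ(γ))` carries the
prime of `x_ε` to the prime of `x_{ε'}` (`primes_congr_pull_eq_of_frobenius_sq`); applying `Ψ` to the
square gives the same relation between `x_{Ψ ε}` and `x_{Ψ ε'}`.  All hypotheses on `Ψ` (a functor here;
the equivalence of the theorem is not needed for this step) are the printed inputs BY NAME, as in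
`PrimaryStepsTransport.lean`.  Composition is diagrammatic; monoids multiplicative.  No new definitions.
-/

namespace Literature.AlgebraicGeometry.Frobenioids

open CategoryTheory Opposite

universe uM

/-- Every prime has an element (the subset `𝔭 ⊆ M` of a prime is non-empty).
[cite: MochizukiFrdI2008, §0 p.12] -/
theorem Primes.exists_mem_carrier {M : Type uM} [CommMonoid M] (𝔭 : Primes M) :
    ∃ a : M, a ∈ 𝔭.carrier := by
  obtain ⟨⟨a, ha⟩, rfl⟩ := Quotient.exists_rep 𝔭
  exact ⟨a, ha, rfl⟩

/-- For an isomorphism `e` of monoids: if `x ∈ 𝔭` and `e x ∈ 𝔮` then `Prime(e) 𝔭 = 𝔮`.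
[cite: MochizukiFrdI2008, §0 p.12] -/
theorem Primes.congr_eq_of_mem_carrier {M M' : Type uM} [CommMonoid M] [CommMonoid M'] (e : M ≃* M')
    {𝔭 : Primes M} {𝔮 : Primes M'} {x : M} (hx : x ∈ 𝔭.carrier) (hex : e x ∈ 𝔮.carrier) :
    Primes.congr e 𝔭 = 𝔮 := by
  have h1 : x ∈ (Primes.congr e.symm 𝔮).carrier := by
    rw [Primes.mem_carrier_congr_iff, MulEquiv.symm_symm]
    exact hex
  rw [Primes.eq_of_mem_carrier hx h1, Primes.congr_apply_congr_symm]

namespace PreFrobenioid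

universe w v v' u u' w₂ v₂ v₂' u₂ u₂'

variable {D : Type u} [Category.{v} D] {Φ : Dᵒᵖ ⥤ CommMonCat.{w}}
  {C : Type u'} [Category.{v'} C] {F : C ⥤ ElemFrobenioid Φ}

/-! ### One Frobenioid: the square of Prop. 1.10 (i) with base-isomorphism rows -/

/-- For a commutative square `γ' ≫ ε = ε' ≫ γ` whose columns `γ : B → A`, `γ' : B' → A'` are of
Frobenius type and whose rows `ε' : B' → B`, `ε : A' → A` are base-isomorphisms:
`γ^*(x_ε) = deg_Fr(γ) · x_{ε'}` in `Φ(B)` (multiplicatively `x_{ε'} ^ deg_Fr(γ)`), where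
`x_ψ = (ψ^*)⁻¹(Div ψ)` — from Prop. 1.10 (i) "`Div(φ') = d · α_*(Div(φ))`".
[cite: MochizukiFrdI2008, Prop. 1.10(i) p.34] -/
theorem pull_base_invDiv_of_frobenius_sq {B' B A' A : C} {ε' : B' ⟶ B} {γ : B ⟶ A} {γ' : B' ⟶ A'}
    {ε : A' ⟶ A} (h : γ' ≫ ε = ε' ≫ γ) (hγ : IsFrobeniusType F γ) (hγ' : IsFrobeniusType F γ')
    (hε : IsBaseIso F ε) (hε' : IsBaseIso F ε') :
    pull Φ (Base F γ) (invDiv F ε hε) = invDiv F ε' hε' ^ (degFr F γ : ℕ) := by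
  haveI : IsIso (Base F ε') := hε'
  haveI : IsIso (Base F γ') := hγ'.2
  apply pull_injective_of_isIso Φ (Base F ε')
  rw [map_pow, pull_invDiv ε' hε', ← pull_comp, ← base_comp, ← h, base_comp, pull_comp,
    pull_invDiv ε hε, div_frobeniusConjugate h hγ' hγ, map_pow, pull_pull_inv]

/-- In the situation of `pull_base_invDiv_of_frobenius_sq`: `x_ε` is primary iff `x_{ε'}` is (`Φ(B)`
is sharp and `γ^*` is an isomorphism of monoids). [cite: MochizukiFrdI2008, Thm. 4.2 (ii) p.80] -/
theorem isPrimary_invDiv_iff_of_frobenius_sq (hP : IsPreFrobenioid Φ F) {B' B A' A : C} {ε' : B' ⟶ B}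
    {γ : B ⟶ A} {γ' : B' ⟶ A'} {ε : A' ⟶ A} (h : γ' ≫ ε = ε' ≫ γ) (hγ : IsFrobeniusType F γ)
    (hγ' : IsFrobeniusType F γ') (hε : IsBaseIso F ε) (hε' : IsBaseIso F ε') :
    IsPrimary (invDiv F ε hε) ↔ IsPrimary (invDiv F ε' hε') := by
  haveI : IsIso (Base F γ) := hγ.2
  have hsharp := (hP.isDivisorial (baseObj F B)).isSharp
  rw [← isPrimary_pull_iff (Base F γ) (invDiv F ε hε), pull_base_invDiv_of_frobenius_sq h hγ hγ' hε hε']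
  constructor
  · intro hx
    refine hx.of_precsim (precsim_pow_self _ (degFr F γ).pos) fun h1 => hx.1 ?_
    rw [h1, one_pow]
  · exact fun hx => hx.pow hsharp (degFr F γ).pos

/-- In the situation of `pull_base_invDiv_of_frobenius_sq` with a pre-step `ε'`: its Frobenius
conjugate `ε` is a pre-step (Prop. 1.10 (i)), and `ε` is a primary pre-step iff `ε'` is.
[cite: MochizukiFrdI2008, Thm. 4.2 (ii) p.80] -/
theorem isPrimaryPreStep_iff_of_frobenius_sq (hF : IsFrobenioid F) {B' B A' A : C} {ε' : B' ⟶ B}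
    {γ : B ⟶ A} {γ' : B' ⟶ A'} {ε : A' ⟶ A} (h : γ' ≫ ε = ε' ≫ γ) (hγ : IsFrobeniusType F γ)
    (hγ' : IsFrobeniusType F γ') (hd : degFr F γ' = degFr F γ) (hε' : IsPreStep F ε') :
    IsPrimaryPreStep F ε ↔ IsPrimaryPreStep F ε' := by
  have hε : IsPreStep F ε := hε'.frobeniusConjugate hF h hγ' hγ hd
  have key := isPrimary_invDiv_iff_of_frobenius_sq hF.isPreFrobenioid h hγ hγ' hε.2 hε'.2
  exact ⟨fun hp => isPrimaryPreStep_of_isPrimary_invDiv hε' (key.mp (isPrimary_invDiv hp)),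
    fun hp' => isPrimaryPreStep_of_isPrimary_invDiv hε (key.mpr (isPrimary_invDiv hp'))⟩

/-- **`Prime(Φ(γ))` on the square of Prop. 1.10 (i)**: for a commutative square `γ' ≫ ε = ε' ≫ γ` with
Frobenius-type columns and base-isomorphism rows, the bijection `Prime(Φ(γ)) = Prime(γ^*)` carries
the prime of `x_ε` to the prime of `x_{ε'}` ("the desired functoriality follows by considering
commutative diagrams … [cf. Proposition 1.10, (i)]"). [cite: MochizukiFrdI2008, Thm. 4.2 (ii) p.80] -/
theorem primes_congr_pull_eq_of_frobenius_sq (hP : IsPreFrobenioid Φ F) {B' B A' A : C}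
    {ε' : B' ⟶ B} {γ : B ⟶ A} {γ' : B' ⟶ A'} {ε : A' ⟶ A} (h : γ' ≫ ε = ε' ≫ γ)
    (hγ : IsFrobeniusType F γ) (hγ' : IsFrobeniusType F γ') (hε : IsBaseIso F ε)
    (hε' : IsBaseIso F ε') {𝔭 : Primes (Φ.obj (op (baseObj F A)))}
    {𝔮 : Primes (Φ.obj (op (baseObj F B)))} (h𝔭 : invDiv F ε hε ∈ 𝔭.carrier)
    (h𝔮 : invDiv F ε' hε' ∈ 𝔮.carrier) :
    haveI : IsIso (Base F γ) := hγ.2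
    Primes.congr (ElemFrobenioid.pullEquiv Φ (Base F γ)) 𝔭 = 𝔮 := by
  haveI : IsIso (Base F γ) := hγ.2
  have hsharp := (hP.isDivisorial (baseObj F B)).isSharp
  -- `γ^* x_ε = x_{ε'} ^ deg γ` lies in `𝔮`
  refine Primes.congr_eq_of_mem_carrier _ h𝔭 ?_
  change pull Φ (Base F γ) (invDiv F ε hε) ∈ 𝔮.carrier
  rw [pull_base_invDiv_of_frobenius_sq h hγ hγ' hε hε']
  exact Primes.pow_mem_carrier hsharp 𝔮 h𝔮 (degFr F γ).pos

/-- **Completing a pre-step into `B` and a morphism of Frobenius type `γ : B → A` to the square of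
Prop. 1.10 (i)**: for a pre-step `ε' : B' → B` there are a morphism of Frobenius type `γ' : B' → A'` of
degree `deg_Fr(γ)` (Def. 1.3 (ii)) and a pre-step `ε : A' → A` with `γ' ≫ ε = ε' ≫ γ` (Prop. 1.10 (i));
`ε` is primary iff `ε'` is. [cite: MochizukiFrdI2008, Thm. 4.2 (ii) p.80] -/
theorem exists_frobenius_sq_of_isPreStep (hF : IsFrobenioid F) {B' B A : C} {ε' : B' ⟶ B}
    (hε' : IsPreStep F ε') {γ : B ⟶ A} (hγ : IsFrobeniusType F γ) :
    ∃ (A' : C) (γ' : B' ⟶ A') (ε : A' ⟶ A), IsFrobeniusType F γ' ∧ degFr F γ' = degFr F γ ∧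
      IsPreStep F ε ∧ γ' ≫ ε = ε' ≫ γ ∧ (IsPrimaryPreStep F ε ↔ IsPrimaryPreStep F ε') := by
  obtain ⟨A', γ', hγ', hd⟩ := hF.ii_exists B' (degFr F γ)
  obtain ⟨ε, h, -⟩ := existsUnique_frobeniusConjugate hF ε' hγ' hγ hd
  exact ⟨A', γ', ε, hγ', hd, hε'.frobeniusConjugate hF h hγ' hγ hd, h,
    isPrimaryPreStep_iff_of_frobenius_sq hF h hγ hγ' hd hε'⟩

/-! ### Two Frobenioids: naturality of `Ψ^Prime` along morphisms of Frobenius type -/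

variable {D₂ : Type u₂} [Category.{v₂} D₂] {Φ₂ : D₂ᵒᵖ ⥤ CommMonCat.{w₂}}
  {C₂ : Type u₂'} [Category.{v₂'} C₂] {F₂ : C₂ ⥤ ElemFrobenioid Φ₂} (Ψ : C ⥤ C₂)

/-- **Theorem 4.2 (ii), functoriality of `Ψ^Prime` with respect to morphisms of Frobenius type** (FrdI
p. 80 ll. 34–43).  Let `C → F_Φ`, `C₂ → F_{Φ₂}` be Frobenioids, `Ψ : C → C₂` a functor preserving
morphisms of Frobenius type [Thm. 3.4 (iii)] and mapping primary pre-steps into `A` (resp. `B`) to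
primary pre-steps [Thm. 4.2 (i)], and let `e_A : Prime(Φ(A)) ≃ Prime(Φ₂(Ψ A))`, `e_B` be bijections
carrying the prime of `x_ε` to the prime of `x_{Ψ ε}` for every primary pre-step `ε` into `A`
(resp. `B`) [the bijections `Ψ^Prime` of `existsUnique_primesEquiv`].  Then for every morphism of
Frobenius type `γ : B → A`, `e_B ∘ Prime(Φ(γ)) = Prime(Φ₂(Ψ γ)) ∘ e_A`, where
`Prime(Φ(γ)) : Prime(Φ(A)) ⥲ Prime(Φ(B))` is induced by `γ^* : Φ(A) ⥲ Φ(B)`.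
[cite: MochizukiFrdI2008, Thm. 4.2 (ii) p.80] -/
theorem primesEquiv_naturality_frobeniusType (hF : IsFrobenioid F) (hF₂ : IsFrobenioid F₂)
    (hfrob : ∀ ⦃X Y : C⦄ (φ : X ⟶ Y), IsFrobeniusType F φ → IsFrobeniusType F₂ (Ψ.map φ))
    {B A : C}
    (hprimA : ∀ ⦃E : C⦄ (ε : E ⟶ A), IsPrimaryPreStep F ε → IsPrimaryPreStep F₂ (Ψ.map ε))
    (hprimB : ∀ ⦃E : C⦄ (ε : E ⟶ B), IsPrimaryPreStep F ε → IsPrimaryPreStep F₂ (Ψ.map ε))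
    (eA : Primes (Φ.obj (op (baseObj F A))) ≃ Primes (Φ₂.obj (op (baseObj F₂ (Ψ.obj A)))))
    (eB : Primes (Φ.obj (op (baseObj F B))) ≃ Primes (Φ₂.obj (op (baseObj F₂ (Ψ.obj B)))))
    (heA : ∀ ⦃E : C⦄ (ε : E ⟶ A) (hε : IsPrimaryPreStep F ε) (𝔭 : Primes (Φ.obj (op (baseObj F A)))),
      invDiv F ε hε.1.2 ∈ 𝔭.carrier → invDiv F₂ (Ψ.map ε) (hprimA ε hε).1.2 ∈ (eA 𝔭).carrier)
    (heB : ∀ ⦃E : C⦄ (ε : E ⟶ B) (hε : IsPrimaryPreStep F ε) (𝔮 : Primes (Φ.obj (op (baseObj F B)))),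
      invDiv F ε hε.1.2 ∈ 𝔮.carrier → invDiv F₂ (Ψ.map ε) (hprimB ε hε).1.2 ∈ (eB 𝔮).carrier)
    (γ : B ⟶ A) (hγ : IsFrobeniusType F γ) (𝔭 : Primes (Φ.obj (op (baseObj F A)))) :
    haveI : IsIso (Base F γ) := hγ.2
    haveI : IsIso (Base F₂ (Ψ.map γ)) := (hfrob γ hγ).2
    eB (Primes.congr (ElemFrobenioid.pullEquiv Φ (Base F γ)) 𝔭) =
      Primes.congr (ElemFrobenioid.pullEquiv Φ₂ (Base F₂ (Ψ.map γ))) (eA 𝔭) := by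
  haveI : IsIso (Base F γ) := hγ.2
  haveI : IsIso (Base F₂ (Ψ.map γ)) := (hfrob γ hγ).2
  have hP := hF.isPreFrobenioid
  have hP₂ := hF₂.isPreFrobenioid
  -- a primary pre-step `ε' : B' → B` representing the prime `γ^* 𝔭` of `Φ(B)`
  set 𝔮 := Primes.congr (ElemFrobenioid.pullEquiv Φ (Base F γ)) 𝔭 with h𝔮def
  obtain ⟨B', ε', hε', hε'𝔮⟩ := exists_isPrimaryPreStep_invDiv_mem hF B 𝔮
  -- the square of Prop. 1.10 (i): `γ' ≫ ε = ε' ≫ γ`, `ε : A' → A` a primary pre-step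
  obtain ⟨A', γ', ε, hγ', -, hεpre, hsq, hiff⟩ := exists_frobenius_sq_of_isPreStep hF hε'.1 hγ
  have hε : IsPrimaryPreStep F ε := hiff.mpr hε'
  -- `x_ε ∈ 𝔭`: `Prime(Φ(γ))` carries the prime of `x_ε` to `𝔮 = Prime(Φ(γ)) 𝔭`
  have h1 : Primes.congr (ElemFrobenioid.pullEquiv Φ (Base F γ))
      (Quotient.mk _ ⟨_, isPrimary_invDiv hε⟩) = 𝔮 :=
    primes_congr_pull_eq_of_frobenius_sq hP hsq hγ hγ' hε.1.2 hε'.1.2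
      (mem_carrier_mk_of_isPrimary _) hε'𝔮
  have h2 : (Quotient.mk _ ⟨_, isPrimary_invDiv hε⟩ : Primes (Φ.obj (op (baseObj F A)))) = 𝔭 :=
    (Primes.congr (ElemFrobenioid.pullEquiv Φ (Base F γ))).injective (h1.trans h𝔮def)
  have hε𝔭 : invDiv F ε hε.1.2 ∈ 𝔭.carrier := h2 ▸ mem_carrier_mk_of_isPrimary _
  -- apply `Ψ` to the square and read off the primes in `C₂`
  have hsq₂ : Ψ.map γ' ≫ Ψ.map ε = Ψ.map ε' ≫ Ψ.map γ := by
    rw [← Functor.map_comp, hsq, Functor.map_comp]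
  exact (primes_congr_pull_eq_of_frobenius_sq hP₂ hsq₂ (hfrob γ hγ) (hfrob γ' hγ')
    (hprimA ε hε).1.2 (hprimB ε' hε').1.2 (heA ε hε 𝔭 hε𝔭) (heB ε' hε' 𝔮 hε'𝔮)).symm

/-- **Theorem 4.2 (ii), functoriality of `Ψ^Prime` with respect to morphisms of Frobenius type**,
carrier form: if the primes `𝔭 ⊆ Φ(A)` and `𝔮 ⊆ Φ(B)` correspond under `γ^*` (some `x ∈ 𝔭` has
`γ^* x ∈ 𝔮`), then `e_A 𝔭 ⊆ Φ₂(Ψ A)` and `e_B 𝔮 ⊆ Φ₂(Ψ B)` correspond under `(Ψ γ)^*`.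
[cite: MochizukiFrdI2008, Thm. 4.2 (ii) p.80] -/
theorem primesEquiv_naturality_frobeniusType_mem (hF : IsFrobenioid F) (hF₂ : IsFrobenioid F₂)
    (hfrob : ∀ ⦃X Y : C⦄ (φ : X ⟶ Y), IsFrobeniusType F φ → IsFrobeniusType F₂ (Ψ.map φ))
    {B A : C}
    (hprimA : ∀ ⦃E : C⦄ (ε : E ⟶ A), IsPrimaryPreStep F ε → IsPrimaryPreStep F₂ (Ψ.map ε))
    (hprimB : ∀ ⦃E : C⦄ (ε : E ⟶ B), IsPrimaryPreStep F ε → IsPrimaryPreStep F₂ (Ψ.map ε))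
    (eA : Primes (Φ.obj (op (baseObj F A))) ≃ Primes (Φ₂.obj (op (baseObj F₂ (Ψ.obj A)))))
    (eB : Primes (Φ.obj (op (baseObj F B))) ≃ Primes (Φ₂.obj (op (baseObj F₂ (Ψ.obj B)))))
    (heA : ∀ ⦃E : C⦄ (ε : E ⟶ A) (hε : IsPrimaryPreStep F ε) (𝔭 : Primes (Φ.obj (op (baseObj F A)))),
      invDiv F ε hε.1.2 ∈ 𝔭.carrier → invDiv F₂ (Ψ.map ε) (hprimA ε hε).1.2 ∈ (eA 𝔭).carrier)
    (heB : ∀ ⦃E : C⦄ (ε : E ⟶ B) (hε : IsPrimaryPreStep F ε) (𝔮 : Primes (Φ.obj (op (baseObj F B)))),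
      invDiv F ε hε.1.2 ∈ 𝔮.carrier → invDiv F₂ (Ψ.map ε) (hprimB ε hε).1.2 ∈ (eB 𝔮).carrier)
    (γ : B ⟶ A) (hγ : IsFrobeniusType F γ) (𝔭 : Primes (Φ.obj (op (baseObj F A))))
    (𝔮 : Primes (Φ.obj (op (baseObj F B))))
    (h𝔭𝔮 : ∃ x ∈ 𝔭.carrier, pull Φ (Base F γ) x ∈ 𝔮.carrier) :
    ∃ y ∈ (eA 𝔭).carrier, pull Φ₂ (Base F₂ (Ψ.map γ)) y ∈ (eB 𝔮).carrier := by
  haveI : IsIso (Base F γ) := hγ.2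
  haveI : IsIso (Base F₂ (Ψ.map γ)) := (hfrob γ hγ).2
  obtain ⟨x, hx, hγx⟩ := h𝔭𝔮
  have h𝔮 : Primes.congr (ElemFrobenioid.pullEquiv Φ (Base F γ)) 𝔭 = 𝔮 :=
    Primes.congr_eq_of_mem_carrier _ hx hγx
  have key := primesEquiv_naturality_frobeniusType Ψ hF hF₂ hfrob hprimA hprimB eA eB heA heB γ hγ 𝔭
  rw [h𝔮] at key
  obtain ⟨y, hy⟩ := (eA 𝔭).exists_mem_carrier
  refine ⟨y, hy, ?_⟩
  rw [key, Primes.mem_carrier_congr_iff]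
  change pull Φ₂ (inv (Base F₂ (Ψ.map γ))) (pull Φ₂ (Base F₂ (Ψ.map γ)) y) ∈ (eA 𝔭).carrier
  rwa [pull_inv_pull]

end PreFrobenioid

end Literature.AlgebraicGeometry.Frobenioids
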